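import Summits.QuantumFields.YangMills.Theorems.CoarseStiffnessTailCappedCoarseStiffnessLCommVolumeLowerCore

/-!
# Route `CoarseStiffnessTail` — ALMOST-COMMUTING TRIPLES IN `SU(2)`, LOWER HALF OF THE `ε⁴` LAW: THE FIBRED SET AND THE BASE BOX
# (lead's certificate, seat `ym-line-cst-p1` g15; helper on 25301 `CappedCoarseStiffnessL`, stub S3 = uniform mean action, P2/(W3, sets))

Set-theoretic plumbing for `…LCommVolumeLower` (print's chart `g = e^{iA}`, [Balaban1985UV3] p.260): the fibred box
`C_η = {(A,X) : A ∈ G, X ∈ P_η(A)} ⊂ ℝ³ × ℝ³` (`G = [−1/4,1/4]² × [1/2,1]`, `P_η(A)` the sheared fibre of `…LCommVolumeLowerCore`) is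
compact (`isCompact_fibredBox`), so its image `S_η ⊂ SU(2)²` under the chart is measurable (`measurableSet_fibredImage`); the product of
the three coordinate indicators of a fibre is `≤ 1` and vanishes off the fibre; the base box is the preimage of a coordinate box of
Lebesgue volume `1/8` (`volume_box`).

HONEST SCOPE.  Plumbing; nothing of Bałaban's is asserted; the crux 25301, its stubs S1/S2/S3, `HistoryTailL` 19936 stay OPEN; `YM3TorusSU2`
(R3, RECORD rung, not Clay) is NOT proved; the Yang–Mills mass gap is NOT touched.

References: T. Bałaban, CMP **102** (1985) 255–275 [Balaban1985UV3] (p.260); [folklore].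
-/

noncomputable section

open MeasureTheory Real
open scoped ENNReal BigOperators

namespace Summit.QuantumFields.YangMills.Theorems.CoarseStiffnessTailCommVolumeLowerSets

open Literature.MathematicalPhysics.QuantumFieldTheory.Balaban1983to89
open Literature.MathematicalPhysics.QuantumFieldTheory.Balaban1983to89.B10Eq18SigmaSU2Haar (expPauli continuous_expPauli)
open Summit.QuantumFields.YangMills.Theorems.CoarseStiffnessTailCommVolumeLowerCore

/-! ## §1 The fibred box and its image -/

section Fibred

/-- The fibred box `C_η = {(A,X) : A ∈ G, X ∈ P_η(A)} ⊂ ℝ³ × ℝ³` is compact (`η ≤ 1/4`). [folklore] -/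
theorem isCompact_fibredBox {η : ℝ} (hη' : η ≤ 1 / 4) :
    IsCompact {p : EuclideanSpace ℝ (Fin 3) × EuclideanSpace ℝ (Fin 3) |
      (|p.1 0| ≤ 1 / 4 ∧ |p.1 1| ≤ 1 / 4 ∧ 1 / 2 ≤ p.1 2 ∧ p.1 2 ≤ 1) ∧
      (|p.2 2| ≤ 1 / 2 ∧ |p.1 2 * p.2 0 - p.1 0 * p.2 2| ≤ η ∧ |p.1 2 * p.2 1 - p.1 1 * p.2 2| ≤ η)} := by
  have hK : IsCompact ((Metric.closedBall (0 : EuclideanSpace ℝ (Fin 3)) 2) ×ˢ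
      (Metric.closedBall (0 : EuclideanSpace ℝ (Fin 3)) 2)) :=
    (isCompact_closedBall _ _).prod (isCompact_closedBall _ _)
  have h0 : IsClosed {p : EuclideanSpace ℝ (Fin 3) × EuclideanSpace ℝ (Fin 3) | |p.1 0| ≤ 1 / 4} :=
    isClosed_le (continuous_abs.comp (by fun_prop)) continuous_const
  have h1 : IsClosed {p : EuclideanSpace ℝ (Fin 3) × EuclideanSpace ℝ (Fin 3) | |p.1 1| ≤ 1 / 4} :=
    isClosed_le (continuous_abs.comp (by fun_prop)) continuous_const
  have h2 : IsClosed {p : EuclideanSpace ℝ (Fin 3) × EuclideanSpace ℝ (Fin 3) | 1 / 2 ≤ p.1 2} :=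
    isClosed_le continuous_const (by fun_prop)
  have h3 : IsClosed {p : EuclideanSpace ℝ (Fin 3) × EuclideanSpace ℝ (Fin 3) | p.1 2 ≤ 1} :=
    isClosed_le (by fun_prop) continuous_const
  have g0 : IsClosed {p : EuclideanSpace ℝ (Fin 3) × EuclideanSpace ℝ (Fin 3) | |p.2 2| ≤ 1 / 2} :=
    isClosed_le (continuous_abs.comp (by fun_prop)) continuous_const
  have g1 : IsClosed {p : EuclideanSpace ℝ (Fin 3) × EuclideanSpace ℝ (Fin 3) | |p.1 2 * p.2 0 - p.1 0 * p.2 2| ≤ η} :=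
    isClosed_le (continuous_abs.comp (by fun_prop)) continuous_const
  have g2 : IsClosed {p : EuclideanSpace ℝ (Fin 3) × EuclideanSpace ℝ (Fin 3) | |p.1 2 * p.2 1 - p.1 1 * p.2 2| ≤ η} :=
    isClosed_le (continuous_abs.comp (by fun_prop)) continuous_const
  have hC : IsClosed {p : EuclideanSpace ℝ (Fin 3) × EuclideanSpace ℝ (Fin 3) |
      (|p.1 0| ≤ 1 / 4 ∧ |p.1 1| ≤ 1 / 4 ∧ 1 / 2 ≤ p.1 2 ∧ p.1 2 ≤ 1) ∧
      (|p.2 2| ≤ 1 / 2 ∧ |p.1 2 * p.2 0 - p.1 0 * p.2 2| ≤ η ∧ |p.1 2 * p.2 1 - p.1 1 * p.2 2| ≤ η)} :=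
    (h0.inter (h1.inter (h2.inter h3))).inter (g0.inter (g1.inter g2))
  refine hK.of_isClosed_subset hC ?_
  rintro ⟨A, X⟩ ⟨⟨hA0, hA1, hA2, hA2'⟩, hX2, hu, hv⟩
  have hπ : π / 2 ≤ 2 := by linarith [Real.pi_le_four]
  refine Set.mk_mem_prod ?_ ?_
  · rw [Metric.mem_closedBall, dist_zero_right]
    exact (norm_le_of_box hA0 hA1 hA2 hA2').trans hπ
  · rw [Metric.mem_closedBall, dist_zero_right]
    exact (norm_le_of_fibre hη' hA0 hA1 hA2 hX2 hu hv).trans hπ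

/-- `S_η = (e^{i·} × e^{i·})(C_η) ⊂ SU(2)²` is measurable (compact image of a compact set). [folklore] -/
theorem measurableSet_fibredImage {η : ℝ} (hη' : η ≤ 1 / 4) :
    MeasurableSet ((fun p : EuclideanSpace ℝ (Fin 3) × EuclideanSpace ℝ (Fin 3) => (expPauli p.1, expPauli p.2)) ''
      {p : EuclideanSpace ℝ (Fin 3) × EuclideanSpace ℝ (Fin 3) |
        (|p.1 0| ≤ 1 / 4 ∧ |p.1 1| ≤ 1 / 4 ∧ 1 / 2 ≤ p.1 2 ∧ p.1 2 ≤ 1) ∧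
        (|p.2 2| ≤ 1 / 2 ∧ |p.1 2 * p.2 0 - p.1 0 * p.2 2| ≤ η ∧ |p.1 2 * p.2 1 - p.1 1 * p.2 2| ≤ η)}) := by
  refine (IsCompact.isClosed ((isCompact_fibredBox hη').image ?_)).measurableSet
  exact (continuous_expPauli.comp continuous_fst).prodMk (continuous_expPauli.comp continuous_snd)

/-- `dist1[h,g] = dist1[g,h]` (inverse words). [folklore] -/
theorem dist1_comm_symm {G : Type*} [GaugeGroup G] (g h : G) :
    dist1 (h * g * h⁻¹ * g⁻¹) = dist1 (g * h * g⁻¹ * h⁻¹) := by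
  rw [← GaugeGroup.dist1_inv (g * h * g⁻¹ * h⁻¹)]
  congr 1
  group

end Fibred

/-! ## §2 The coordinate indicators of a fibre -/

section Indicators

/-- Off the fibre the product of the three coordinate indicators vanishes. [folklore] -/
theorem fibreIndicator_eq_zero {A X : EuclideanSpace ℝ (Fin 3)} {η : ℝ}
    (hX : ¬ (|X 2| ≤ 1 / 2 ∧ |A 2 * X 0 - A 0 * X 2| ≤ η ∧ |A 2 * X 1 - A 1 * X 2| ≤ η)) :
    {x : Fin 3 → ℝ | |x 2| ≤ 1 / 2}.indicator (1 : (Fin 3 → ℝ) → ℝ≥0∞) (WithLp.ofLp X) *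
      ({x : Fin 3 → ℝ | |(WithLp.ofLp A) 2 * x 0 - (WithLp.ofLp A) 0 * x 2| ≤ η}.indicator (1 : (Fin 3 → ℝ) → ℝ≥0∞)
          (WithLp.ofLp X) *
        {x : Fin 3 → ℝ | |(WithLp.ofLp A) 2 * x 1 - (WithLp.ofLp A) 1 * x 2| ≤ η}.indicator (1 : (Fin 3 → ℝ) → ℝ≥0∞)
          (WithLp.ofLp X)) = 0 := by
  classical
  by_cases hP : |X 2| ≤ 1 / 2
  · by_cases hQ : |A 2 * X 0 - A 0 * X 2| ≤ η
    · have hR : WithLp.ofLp X ∉ {x : Fin 3 → ℝ | |(WithLp.ofLp A) 2 * x 1 - (WithLp.ofLp A) 1 * x 2| ≤ η} :=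
        fun hR => hX ⟨hP, hQ, hR⟩
      rw [Set.indicator_of_notMem hR, mul_zero, mul_zero]
    · have hQ' : WithLp.ofLp X ∉ {x : Fin 3 → ℝ | |(WithLp.ofLp A) 2 * x 0 - (WithLp.ofLp A) 0 * x 2| ≤ η} := hQ
      rw [Set.indicator_of_notMem hQ', zero_mul, mul_zero]
  · have hP' : WithLp.ofLp X ∉ {x : Fin 3 → ℝ | |x 2| ≤ 1 / 2} := hP
    rw [Set.indicator_of_notMem hP', zero_mul]

/-- The product of the three coordinate indicators is `≤ 1`. [folklore] -/
theorem fibreIndicator_le_one (A X : EuclideanSpace ℝ (Fin 3)) (η : ℝ) :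
    {x : Fin 3 → ℝ | |x 2| ≤ 1 / 2}.indicator (1 : (Fin 3 → ℝ) → ℝ≥0∞) (WithLp.ofLp X) *
      ({x : Fin 3 → ℝ | |(WithLp.ofLp A) 2 * x 0 - (WithLp.ofLp A) 0 * x 2| ≤ η}.indicator (1 : (Fin 3 → ℝ) → ℝ≥0∞)
          (WithLp.ofLp X) *
        {x : Fin 3 → ℝ | |(WithLp.ofLp A) 2 * x 1 - (WithLp.ofLp A) 1 * x 2| ≤ η}.indicator (1 : (Fin 3 → ℝ) → ℝ≥0∞)
          (WithLp.ofLp X)) ≤ 1 := by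
  have h : ∀ (s : Set (Fin 3 → ℝ)) (x : Fin 3 → ℝ), s.indicator (1 : (Fin 3 → ℝ) → ℝ≥0∞) x ≤ 1 :=
    fun s x => Set.indicator_apply_le' (fun _ => le_rfl) (fun _ => bot_le)
  calc _ ≤ (1 : ℝ≥0∞) * (1 * 1) := mul_le_mul' (h _ _) (mul_le_mul' (h _ _) (h _ _))
    _ = 1 := by rw [one_mul, one_mul]

/-- The fibre lies in the chart ball: off `|X| < π` the product of indicators vanishes (`η ≤ 1/4`, `A ∈ G`). [folklore] -/
theorem fibreIndicator_eq_zero_of_not_mem_ball {A X : EuclideanSpace ℝ (Fin 3)} {η : ℝ} (hη' : η ≤ 1 / 4)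
    (hA0 : |A 0| ≤ 1 / 4) (hA1 : |A 1| ≤ 1 / 4) (hA2 : 1 / 2 ≤ A 2)
    (hXb : X ∉ Metric.ball (0 : EuclideanSpace ℝ (Fin 3)) π) :
    {x : Fin 3 → ℝ | |x 2| ≤ 1 / 2}.indicator (1 : (Fin 3 → ℝ) → ℝ≥0∞) (WithLp.ofLp X) *
      ({x : Fin 3 → ℝ | |(WithLp.ofLp A) 2 * x 0 - (WithLp.ofLp A) 0 * x 2| ≤ η}.indicator (1 : (Fin 3 → ℝ) → ℝ≥0∞)
          (WithLp.ofLp X) *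
        {x : Fin 3 → ℝ | |(WithLp.ofLp A) 2 * x 1 - (WithLp.ofLp A) 1 * x 2| ≤ η}.indicator (1 : (Fin 3 → ℝ) → ℝ≥0∞)
          (WithLp.ofLp X)) = 0 := by
  refine fibreIndicator_eq_zero fun ⟨hX2, hu, hv⟩ => hXb ?_
  rw [Metric.mem_ball, dist_zero_right]
  exact lt_of_le_of_lt (norm_le_of_fibre hη' hA0 hA1 hA2 hX2 hu hv) (by linarith [Real.pi_pos])

end Indicators

/-! ## §3 The base box -/

section Box

/-- The base box as the preimage of a coordinate box. [folklore] -/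
theorem box_eq_preimage :
    {A : EuclideanSpace ℝ (Fin 3) | |A 0| ≤ 1 / 4 ∧ |A 1| ≤ 1 / 4 ∧ 1 / 2 ≤ A 2 ∧ A 2 ≤ 1} =
      WithLp.ofLp ⁻¹' Set.Icc (![-(1 / 4), -(1 / 4), 1 / 2] : Fin 3 → ℝ) ![1 / 4, 1 / 4, 1] := by
  ext A
  simp only [Set.mem_setOf_eq, Set.mem_preimage, Set.mem_Icc, Pi.le_def, Fin.forall_fin_succ, IsEmpty.forall_iff,
    Matrix.cons_val_zero, Matrix.cons_val_succ, abs_le, and_true]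
  constructor
  · rintro ⟨⟨h0, h0'⟩, ⟨h1, h1'⟩, h2, h2'⟩; exact ⟨⟨h0, h1, h2⟩, h0', h1', h2'⟩
  · rintro ⟨⟨h0, h1, h2⟩, h0', h1', h2'⟩; exact ⟨⟨h0, h0'⟩, ⟨h1, h1'⟩, h2, h2'⟩

/-- The base box is measurable. [folklore] -/
theorem measurableSet_box :
    MeasurableSet {A : EuclideanSpace ℝ (Fin 3) | |A 0| ≤ 1 / 4 ∧ |A 1| ≤ 1 / 4 ∧ 1 / 2 ≤ A 2 ∧ A 2 ≤ 1} := by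
  rw [box_eq_preimage]
  exact measurableSet_Icc.preimage (PiLp.volume_preserving_ofLp (Fin 3)).measurable

/-- **THE BASE BOX HAS VOLUME `1/8`.** [folklore] -/
theorem volume_box :
    (volume : Measure (EuclideanSpace ℝ (Fin 3))) {A : EuclideanSpace ℝ (Fin 3) |
      |A 0| ≤ 1 / 4 ∧ |A 1| ≤ 1 / 4 ∧ 1 / 2 ≤ A 2 ∧ A 2 ≤ 1} = ENNReal.ofReal (1 / 8) := by
  rw [box_eq_preimage, (PiLp.volume_preserving_ofLp (Fin 3)).measure_preimage measurableSet_Icc.nullMeasurableSet,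
    Real.volume_Icc_pi, Fin.prod_univ_three]
  simp only [Matrix.cons_val_zero, Matrix.cons_val_one, Matrix.cons_val]
  rw [← ENNReal.ofReal_mul (by norm_num), ← ENNReal.ofReal_mul (by norm_num)]
  norm_num

/-- The base box lies in the chart ball. [folklore] -/
theorem box_subset_ball :
    {A : EuclideanSpace ℝ (Fin 3) | |A 0| ≤ 1 / 4 ∧ |A 1| ≤ 1 / 4 ∧ 1 / 2 ≤ A 2 ∧ A 2 ≤ 1} ⊆
      Metric.ball (0 : EuclideanSpace ℝ (Fin 3)) π := by
  rintro A ⟨hA0, hA1, hA2, hA2'⟩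
  rw [Metric.mem_ball, dist_zero_right]
  exact lt_of_le_of_lt (norm_le_of_box hA0 hA1 hA2 hA2') (by linarith [Real.pi_pos])

end Box

end Summit.QuantumFields.YangMills.Theorems.CoarseStiffnessTailCommVolumeLowerSets

end
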